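import Literature.AnabelianGeometry.AbsoluteAnabelian.AbsTopIII.ReconstructionCor110iaNaturalProofs
import Literature.AnabelianGeometry.AbsoluteAnabelian.MonoidKummerMapsProp32iH2IsoEqPairs
import Literature.AnabelianGeometry.AbsoluteAnabelian.GaloisCyclotomeH2TwoTowersOfRecord
import HarnessLib

/-!
# [AbsTopIII] Prop. 3.2 (i): the natural isomorphism `H²(G, μ_Ẑ(M_TM)) ⥲ Ẑ` of the Kummer theory OF RECORD
# is PRESENTATION-INDEPENDENT (a function of the abstract topological group `G`)

S. Mochizuki, *Topics in Absolute Anabelian Geometry III*, Prop. 3.2 (i) p. 71 l. 15–21 («a functorial … algorithm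
for constructing the natural isomorphism `H²(G, μ_Ẑ(M_TM)) ⥲ Ẑ`»), Rmk. 3.2.1 p. 73 l. 11–16 («the algorithm applied
to construct the natural isomorphism of Corollary 1.10, (a), is essentially the same as the algorithm of
Proposition 3.2, (i)»); kurims render `url-5493eb38cbb7`.  abc-iut cell, layer L4, sub-DAG [AbsTopIII] Prop. 3.2 (i),
row «P32i-PRESENTATION-INDEP» (L4-lead RULING #8d (5): «∃-form over `IsMLFGaloisMonoidPair.exists_model`
acceptable iff the constructed iso is shown presentation-independent»).
The tree's Kummer theory OF RECORD of an abstract MLF-Galois `TM`-pair `P` is abc-iut-L4-t2's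
`π.kummerTheoryStd R` for a model presentation `π` (field `k = π.C.k`), whose `h2Iso` is the LCFT chain
`MLFClosure.galH2EquivZhat` on `H²_cont(G_k, Ẑ(1))` (abc-iut-L4-t11/t16) — it does NOT involve `R`.  Read on the
GROUP-theoretic `H²(G_k, μ_Ẑ(G_k))` through THE canonical coefficient identification
`Cor110iaNat.iso k = galCyclotomeIsoTateModule k D_k.equiv _` (`D_k` THE characterised torsion-reciprocity datum,
abc-iut-L4-d1), this `h2Iso` IS abc-iut-L4-d1's natural residue isomorphism `r_k = Cor110iaNat.residueIso k`
(DEFINITIONAL: `kummerTheoryStd_h2Iso_iso_eq_residueIso`), whence by `Cor110iaNat.residueIso_chart_independent`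
(`AbsTopIII.cor_1_10_i_a_natural_holds`, p438943; [AbsAnab] Prop. 1.2.1 (vii) «`α` preserves the residue map»):
* **`kummerTheoryStd_h2Iso_chart_independent`** — for ANY two presentations `π₁`, `π₂` (of the same or of different
  pairs, any data `R₁`, `R₂`) and ANY two charts `ι_j : G ≃ₜ* G_{k_j}` of an abstract topological group `G`, the two
  `h2Iso`'s read on `H²(G, μ_Ẑ(G))` give the same element of `Ẑ` — the isomorphism of Prop. 3.2 (i) is a function of
  the topological group, as print's «group-theoretic» demands (Rmk. 1.9.8);
* **`chainStd_h2IsoOfChain_chart_independent`** — the same for the COMPOSITE OF THE PRINTED BRAUER CHAIN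
  (abc-iut-w6-d075's `ModelPresentation.chainStd π R (−id)`, `H2IsoEq` by `chainStd_neg_h2IsoEq`, p438734), although
  the chain's own `Hom(ℚ/ℤ, −)`-arrow is built from `R`;
* `genuineH2Iso_datum_eq_residueIso` — abc-iut-w6-d075's `Hom(ℚ/ℤ, −)`-route `genuineH2Iso k R` at THE datum
  `R = D_k` IS `r_k` as well (via `galH2EquivZhat_galCyclotomeH2EquivGalH2`, p438291, and
  `galCyclotomeIsoTateModule_hom_eq`, p438031).
HONEST FRAMING: proof-only bookkeeping over landed theorems (classical LCFT); the residual of (i) at print strength is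
ONLY its functoriality clause along OPEN INJECTIONS with the index convention (Rmk. 3.2.2 = row P32.i.L07, shared with
Cor. 1.10 (i); abc-iut-L4-d3/t11), not asserted here; nothing here bears on [IUTchIII] Cor. 3.12; no side taken;
model-presented ≠ node-level.

## References
* [MochizukiAbsTopIII2015] S. Mochizuki, *Topics in Absolute Anabelian Geometry III*, Prop. 3.2 (i) p. 71,
  Rmk. 3.2.1 p. 73, Cor. 1.10 (i) p. 42.
* [MochizukiAbsAnab2004] S. Mochizuki, *The absolute anabelian geometry of hyperbolic curves*, Prop. 1.2.1 (vii) p. 11.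
-/

noncomputable section

open CategoryTheory Function
open Field ValuativeRel
open ProfiniteGrp ProfiniteGrp.ProfiniteCompletion

namespace Literature.AnabelianGeometry.AbsoluteAnabelian

open _root_.TopRep _root_.ContRepresentation _root_.ContinuousCohomology
open Literature.NumberTheory.GaloisRepresentations
open Literature.NumberTheory.GaloisRepresentations.DiscreteGaloisModule
open Literature.AnabelianGeometry.EtaleTheta Literature.AnabelianGeometry.EtaleTheta.ZHatLevel

/-! ### The `h2Iso` of record, read through THE canonical coefficient identification, is `r_k` -/

section Record

variable (k : Type) [Field k] [ValuativeRel k] [TopologicalSpace k] [IsNonarchimedeanLocalField k] [CharZero k]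

/-- abc-iut-L4-t2's `MLFClosure.galH2EquivZhat` (the LCFT chain on `H²_cont(G_k, Ẑ(1))`) precomposed with `H²` of THE
canonical coefficient isomorphism `Cor110iaNat.iso k` IS abc-iut-L4-d1's natural residue isomorphism `r_k`
(definitional). [cite: MochizukiAbsTopIII2015, Remark 3.2.1 p.73] -/
theorem galH2EquivZhat_iso_eq_residueIso (x : galCyclotomeH2 (absoluteGaloisGroup k)) :
    ((MLFClosure.std k).galH2EquivZhat ((cohomologyMap (Cor110iaNat.iso k).hom 2).hom x)).down =
      Cor110iaNat.residueIso k x := rfl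

/-- abc-iut-w6-d075's `Hom(ℚ/ℤ, −)`-route `genuineH2Iso k R` at THE characterised datum `R = D_k` IS `r_k`.
[cite: MochizukiAbsTopIII2015, Proposition 3.2 (i) p.71] -/
theorem genuineH2Iso_datum_eq_residueIso (x : galCyclotomeH2 (absoluteGaloisGroup k)) :
    (Prop121vii.genuineH2Iso k (Cor110iaNat.datum k) Prop32iChain.endQmodZCanonical x).down =
      Cor110iaNat.residueIso k x := by
  rw [← Prop121vii.galH2EquivZhat_galCyclotomeH2EquivGalH2, Prop121vii.galCyclotomeH2EquivGalH2_apply,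
    ← galCyclotomeIsoTateModule_hom_eq k (Cor110iaNat.datum k).equiv (Cor110iaNat.datum k).equiv_smul]
  rfl

end Record

/-! ### Presentation independence -/

section Presentations

variable {P₁ P₂ : GaloisMonoidPair.{0}} (π₁ : P₁.ModelPresentation) (π₂ : P₂.ModelPresentation)
  (R₁ : TorsionReciprocityData π₁.C.k) (R₂ : TorsionReciprocityData π₂.C.k)

/-- For a model presentation `π`, the `h2Iso` of the Kummer theory of record `π.kummerTheoryStd R`, read on the
group-theoretic `H²(G_k, μ_Ẑ(G_k))` through THE canonical coefficient identification of its field, is `r_k` — for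
every datum `R` (the `h2Iso` slot does not involve `R`). [cite: MochizukiAbsTopIII2015, Proposition 3.2 (i) p.71] -/
theorem kummerTheoryStd_h2Iso_iso_eq_residueIso (x : galCyclotomeH2 (absoluteGaloisGroup π₁.C.k)) :
    ((π₁.kummerTheoryStd R₁).h2Iso ((cohomologyMap (Cor110iaNat.iso π₁.C.k).hom 2).hom x)).down =
      Cor110iaNat.residueIso π₁.C.k x := rfl

variable {G : Type} [Group G] [TopologicalSpace G] [IsTopologicalGroup G] [CompactSpace G]

/-- **[AbsTopIII] Prop. 3.2 (i) — PRESENTATION INDEPENDENCE of the natural isomorphism `H²(G, μ_Ẑ(M_TM)) ⥲ Ẑ`.**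
For ANY two model presentations `π₁`, `π₂` (of the same abstract MLF-Galois `TM`-pair or of different ones), ANY
torsion-reciprocity data `R₁`, `R₂`, an abstract topological group `G` and ANY two charts `ι_j : G ≃ₜ* G_{k_j}` onto the
absolute Galois groups of the presentations' fields: the `h2Iso`'s of the Kummer theories of record, read on
`H²(G, μ_Ẑ(G))` (transport along `ι_j`, then THE canonical coefficient identification of `k_j`), coincide in `Ẑ` —
the isomorphism is a function of the topological group `G` alone ([AbsAnab] Prop. 1.2.1 (vii) via abc-iut-L4-d1's
`Cor110iaNat.residueIso_chart_independent`). [cite: MochizukiAbsTopIII2015, Proposition 3.2 (i) p.71] -/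
theorem kummerTheoryStd_h2Iso_chart_independent
    (ι₁ : G ≃ₜ* absoluteGaloisGroup π₁.C.k) (ι₂ : G ≃ₜ* absoluteGaloisGroup π₂.C.k) (x : galCyclotomeH2 G) :
    ((π₁.kummerTheoryStd R₁).h2Iso
        ((cohomologyMap (Cor110iaNat.iso π₁.C.k).hom 2).hom (galCyclotomeCohomologyMap ι₁ 2 x))).down =
      ((π₂.kummerTheoryStd R₂).h2Iso
        ((cohomologyMap (Cor110iaNat.iso π₂.C.k).hom 2).hom (galCyclotomeCohomologyMap ι₂ 2 x))).down := by
  rw [kummerTheoryStd_h2Iso_iso_eq_residueIso, kummerTheoryStd_h2Iso_iso_eq_residueIso]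
  exact (Cor110iaNat.residueIso_chart_independent ι₁ ι₂ x).symm

/-- **The same for the COMPOSITE OF THE PRINTED BRAUER CHAIN** (abc-iut-w6-d075's `chainStd π R (−id)` over the
theory of record, `H2IsoEq` by `chainStd_neg_h2IsoEq`): although its `Hom(ℚ/ℤ, −)`-arrow is built from `R`, the
assembled `h2IsoOfChain : H²(G, μ_Ẑ(M_TM)) ⥲ Ẑ`, read on `H²(G, μ_Ẑ(G))` through any chart, does not depend on the
presentation, the datum or the chart. [cite: MochizukiAbsTopIII2015, Proposition 3.2 (i) p.71] -/
theorem chainStd_h2IsoOfChain_chart_independent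
    (ι₁ : G ≃ₜ* absoluteGaloisGroup π₁.C.k) (ι₂ : G ≃ₜ* absoluteGaloisGroup π₂.C.k) (x : galCyclotomeH2 G) :
    ((π₁.chainStd R₁ (AddEquiv.neg _)).h2IsoOfChain
        ((cohomologyMap (Cor110iaNat.iso π₁.C.k).hom 2).hom (galCyclotomeCohomologyMap ι₁ 2 x))).down =
      ((π₂.chainStd R₂ (AddEquiv.neg _)).h2IsoOfChain
        ((cohomologyMap (Cor110iaNat.iso π₂.C.k).hom 2).hom (galCyclotomeCohomologyMap ι₂ 2 x))).down := by
  have h₁ : (π₁.chainStd R₁ (AddEquiv.neg _)).h2IsoOfChain = (π₁.kummerTheoryStd R₁).h2Iso :=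
    (GaloisMonoidPair.ModelPresentation.chainStd_neg_h2IsoEq (π := π₁) (R := R₁)).symm
  have h₂ : (π₂.chainStd R₂ (AddEquiv.neg _)).h2IsoOfChain = (π₂.kummerTheoryStd R₂).h2Iso :=
    (GaloisMonoidPair.ModelPresentation.chainStd_neg_h2IsoEq (π := π₂) (R := R₂)).symm
  rw [h₁, h₂]
  exact kummerTheoryStd_h2Iso_chart_independent π₁ π₂ R₁ R₂ ι₁ ι₂ x

/-- Specialisation: two presentations `π₁`, `π₂` of the SAME abstract pair `P`, read through the same chart
machinery. [cite: MochizukiAbsTopIII2015, Proposition 3.2 (i) p.71] -/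
theorem kummerTheoryStd_h2Iso_presentation_independent {P : GaloisMonoidPair.{0}}
    (π₁ π₂ : P.ModelPresentation) (R₁ : TorsionReciprocityData π₁.C.k) (R₂ : TorsionReciprocityData π₂.C.k)
    (ι₁ : G ≃ₜ* absoluteGaloisGroup π₁.C.k) (ι₂ : G ≃ₜ* absoluteGaloisGroup π₂.C.k) (x : galCyclotomeH2 G) :
    ((π₁.kummerTheoryStd R₁).h2Iso
        ((cohomologyMap (Cor110iaNat.iso π₁.C.k).hom 2).hom (galCyclotomeCohomologyMap ι₁ 2 x))).down =
      ((π₂.kummerTheoryStd R₂).h2Iso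
        ((cohomologyMap (Cor110iaNat.iso π₂.C.k).hom 2).hom (galCyclotomeCohomologyMap ι₂ 2 x))).down :=
  kummerTheoryStd_h2Iso_chart_independent π₁ π₂ R₁ R₂ ι₁ ι₂ x

end Presentations

end Literature.AnabelianGeometry.AbsoluteAnabelian

end
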